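import Summits.QuantumFields.YangMills.Theorems.ColdStartUniversalityShenZhuZhuWilsonLoopConcentrationSU2
import HarnessLib

/-!
# Gaussian concentration ON EVERY TORUS, uniformly in the volume: Lipschitz cylinder observables and Wilson loops under the
# periodic `SU(2)` Wilson measures of three-dimensional lattice Yang–Mills at strong coupling (`|β'| < 1/12`)

Seat `ym-line-csu-p1` (g38), route `ColdStartUniversality` of `Summits/QuantumFields/YangMills`, helper file G7 — the FINITE-VOLUME companion
of `…ShenZhuZhuConcentrationSU2` / `…ShenZhuZhuWilsonLoopConcentrationSU2` (infinite-volume limit points): Herbst's argument run directly on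
the torus `(ℤ/L)³` from the seat's gradient-form log-Sobolev inequality `torus_entropy_le_sum_linkGradSq_of_hessBound`
(`…LatticeLangevinGradientFormTorus`, Shen–Zhu–Zhu Cor. 4.4 (4.11) verbatim), with constants that do NOT depend on `L`.

* `torus_herbst_entropy_of_hessBound` — under a frame-Hessian bound `K₀ < 2` at tree coupling `β'`: for `F = f((U_e)_(e∈Λ)) ∘ torusLift`,
  `f` smooth and `ℓ_e`-Lipschitz in the link `e` (Frobenius distance), and every `t`:
  `Ent_{μ_L}(e^{tF}) ≤ (Σ_e ℓ_e² /(2(1 − K₀/2))) t² μ_L(e^{tF})` (Herbst's differential inequality input).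
* `torus_laplace_le_of_hessBound`, `torus_concentration_of_hessBound` — `μ_L(e^{λF}) ≤ exp(λ μ_L F + λ² Σℓ²/(2(1−K₀/2)))` and
  `μ_L{F ≥ μ_L F + r} ≤ exp(−(1 − K₀/2) r²/(2Σ_e ℓ_e²))`.
* ★★★ `torus_concentration_su2_uniform` — `|β'| < 1/12` (frame-Hessian bound `K₀ = 24|β'|` of the seat, `wilson_hessBound`): for EVERY `L ≥ 1`,
  every finite `Λ ⊆ E⁺(ℤ³)` mapped injectively to the torus, every smooth link-Lipschitz `f` and `r ≥ 0`:
  `μ_{L,β'}{F ≥ ⟨F⟩ + r} ≤ exp(−(1 − 12|β'|) r²/(2 Σ_e ℓ_e²))` — the SAME Gaussian bound in every volume.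
* ★★★ `torus_wilsonLoop_twoSided_su2_uniform`, `…_of_isTrail` — Wilson loops `W_C = ½ Re tr hol_C` of closed lattice walks `C` (read on the
  torus through the periodic lift, `L` large enough that the links of `C` are distinct on the torus): for every such `L`,
  `μ_{L,β'}{|W_C − ⟨W_C⟩| ≥ r} ≤ 2 exp(−(1 − 12|β'|) r²/Σ_e mult_C(e)²)`, `≤ 2 exp(−(1 − 12|β'|) r²/|C|)` for closed trails — error bars for
  lattice simulations at strong coupling that are uniform in the volume.

THEOREMS ONLY, no definition, no sorry.  HONEST FRAMING: STRONG coupling (`|β'| < 1/12` tree coupling, i.e. 't Hooft `|β| < 1/24`), fixed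
lattice spacing, `SU(2)`, `d = 3`; nothing at weak coupling / in the continuum, nothing `K`-uniform along the route's scaling
(`UniformColdStartMixing`, 24809, ASIDE, not restated); no crux, rung or summit statement is proved; the Yang–Mills mass gap is NOT proved.

References: H. Shen, R. Zhu, X. Zhu, CMP 400 (2023) 805–851 = arXiv:2204.12737, Cor. 4.4 (4.11), Thm 1.4 [ShenZhuZhu2022]; M. Ledoux,
*The concentration of measure phenomenon* (2001), §5.1 (Herbst).
-/

set_option autoImplicit false

noncomputable section

namespace Summit.QuantumFields.YangMills.Theorems.ColdStartUniversality

open MeasureTheory ProbabilityTheory Finset Filter Set Metric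
open scoped BigOperators NNReal ENNReal Topology Matrix Matrix.Norms.Frobenius ContDiff
open SimpleGraph
open Literature.Probability.LatticeModels (Site zdGraph)
open Literature.Probability.Process Literature.MathematicalPhysics.QuantumFieldTheory
open Literature.MathematicalPhysics.QuantumLattice (fundamentalRep fundamentalLatticeRep continuous_fundamentalRep fundamentalRep_apply
  torusEdge torusLift LGConfig normalisedCharacter wilsonLoopObs)
open Summit.Ventures.YMGap.RobustBall (dartMult)

/-! ## §1. Herbst on the torus under a frame-Hessian bound -/

/-- **Herbst's entropy input on the torus.**  Under a frame-Hessian bound `K₀ < 2` at tree coupling `β'`, for a finite `Λ ⊆ E⁺(ℤ³)` mapped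
injectively to `(ℤ/L)³`, a smooth `f` of the link matrices over `Λ` that is `ℓ_e`-Lipschitz in the link `e` for the Frobenius distance, and
`F = f((U_e)_(e∈Λ)) ∘ torusLift`: `Ent_{μ_L}(e^{tF}) ≤ (Σ_e ℓ_e²/(2(1 − K₀/2))) · t² · μ_L(e^{tF})` for every real `t` (gradient-form log-Sobolev
inequality applied to `e^{tF/2}`, chain rule `|∇_e e^{tF/2}|² = (t/2)² e^{tF} |∇_e F|²`, `|∇_e F|² ≤ ℓ_e²`). [cite: ShenZhuZhu2022, Corollary 4.4 (4.11)] -/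
theorem torus_herbst_entropy_of_hessBound (L : ℕ) [NeZero L] (β' K₀ : ℝ) (hK : K₀ < 2)
    (hHess : (∀ (V : (GaugeConfig 3 L (Matrix.specialUnitaryGroup (Fin 2) ℂ))) (Λ : (Edge 3 L × Fin (fundamentalLatticeRep 2).N × Fin (fundamentalLatticeRep 2).N × Bool → ℝ) →L[ℝ] ℝ),
      ∑ n : Edge 3 L × NoiseIdx (fundamentalLatticeRep 2).N, ∑ m : Edge 3 L × NoiseIdx (fundamentalLatticeRep 2).N,
        Λ ((fun q : Edge 3 L × Fin (fundamentalLatticeRep 2).N × Fin (fundamentalLatticeRep 2).N × Bool => if n.1 = q.1 then (fun z : ℂ => if q.2.2.2 then z.im else z.re) (((Real.sqrt 2 : ℂ) • ((fundamentalLatticeRep 2).lieProj (noiseDir n.2) * (fun (ee : Edge 3 L) => Matrix.of fun (i j : Fin (fundamentalLatticeRep 2).N) => (((fun (V : GaugeConfig 3 L (Matrix.specialUnitaryGroup (Fin 2) ℂ)) (q : Edge 3 L × Fin (fundamentalLatticeRep 2).N × Fin (fundamentalLatticeRep 2).N × Bool) => (fun z : ℂ => if q.2.2.2 then z.im else z.re)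 ((fundamentalRep (Fin 2) (V q.1) : Matrix (Fin 2) (Fin 2) ℂ) q.2.1 q.2.2.1)) V (ee, i, j, false) : ℝ) : ℂ) + (((fun (V : GaugeConfig 3 L (Matrix.specialUnitaryGroup (Fin 2) ℂ)) (q : Edge 3 L × Fin (fundamentalLatticeRep 2).N × Fin (fundamentalLatticeRep 2).N × Bool) => (fun z : ℂ => if q.2.2.2 then z.im else z.re) ((fundamentalRep (Fin 2) (V q.1) : Matrix (Fin 2) (Fin 2) ℂ) q.2.1 q.2.2.1)) V (ee, i, j, true) : ℝ) : ℂ) * Complex.I) q.1)) q.2.1 q.2.2.1) else 0)) * Λ ((fun q : Edge 3 L × Fin (fundamentalLatticeRep 2).N × Fin (fundamentalLatticeRep 2).N × Bool => if m.1 = q.1 then (fun z : ℂ => if q.2.2.2 then z.im else z.re) (((Real.sqrt 2 : ℂ) • ((fundamentalLatticeRep 2).lieProj (noiseDir m.2) * (fun (ee : Edge 3 L) => Matrix.of fun (i j : Fin (fundamentalLatticeRep 2).N) => (((fun (V : GaugeConfig 3 L (Matrix.specialUnitaryGroup (Fin 2) ℂ)) (q : Edge 3 L × Fin (fundamentalLatticeRep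 2).N × Fin (fundamentalLatticeRep 2).N × Bool) => (fun z : ℂ => if q.2.2.2 then z.im else z.re) ((fundamentalRep (Fin 2) (V q.1) : Matrix (Fin 2) (Fin 2) ℂ) q.2.1 q.2.2.1)) V (ee, i, j, false) : ℝ) : ℂ) + (((fun (V : GaugeConfig 3 L (Matrix.specialUnitaryGroup (Fin 2) ℂ)) (q : Edge 3 L × Fin (fundamentalLatticeRep 2).N × Fin (fundamentalLatticeRep 2).N × Bool) => (fun z : ℂ => if q.2.2.2 then z.im else z.re) ((fundamentalRep (Fin 2) (V q.1) : Matrix (Fin 2) (Fin 2) ℂ) q.2.1 q.2.2.1)) V (ee, i, j, true) : ℝ) : ℂ) * Complex.I) q.1)) q.2.1 q.2.2.1) else 0)) *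
          fderiv ℝ (fun z : (Edge 3 L × Fin (fundamentalLatticeRep 2).N × Fin (fundamentalLatticeRep 2).N × Bool → ℝ) => fderiv ℝ (fun y : (Edge 3 L × Fin (fundamentalLatticeRep 2).N × Fin (fundamentalLatticeRep 2).N × Bool → ℝ) => β' * ∑ p : Plaquette 3 L, (rootedLoop (fun (ee : Edge 3 L) (i j : Fin (fundamentalLatticeRep 2).N) => ((y (ee, i, j, false) : ℝ) : ℂ) + ((y (ee, i, j, true) : ℝ) : ℂ) * Complex.I) (p.1, p.2.1.1) p.2.1.2 false).trace.re) z (fun q : Edge 3 L × Fin (fundamentalLatticeRep 2).N × Fin (fundamentalLatticeRep 2).N × Bool => if m.1 = q.1 then (fun z : ℂ => if q.2.2.2 then z.im else z.re) (((Real.sqrt 2 : ℂ) • ((fundamentalLatticeRep 2).lieProj (noiseDir m.2) * (fun (ee : Edge 3 L) => Matrix.of fun (i j : Fin (fundamentalLatticeRep 2).N) => ((z (ee, i, j, false) : ℝ) : ℂ) + ((z (ee, i, j, true) : ℝ) : ℂ) * Complex.I) q.1)) q.2.1 q.2.2.1) else 0)) ((fun (V : GaugeConfig 3 L (Matrix.specialUnitaryGroup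 (Fin 2) ℂ)) (q : Edge 3 L × Fin (fundamentalLatticeRep 2).N × Fin (fundamentalLatticeRep 2).N × Bool) => (fun z : ℂ => if q.2.2.2 then z.im else z.re) ((fundamentalRep (Fin 2) (V q.1) : Matrix (Fin 2) (Fin 2) ℂ) q.2.1 q.2.2.1)) V) (fun q : Edge 3 L × Fin (fundamentalLatticeRep 2).N × Fin (fundamentalLatticeRep 2).N × Bool => if n.1 = q.1 then (fun z : ℂ => if q.2.2.2 then z.im else z.re) (((Real.sqrt 2 : ℂ) • ((fundamentalLatticeRep 2).lieProj (noiseDir n.2) * (fun (ee : Edge 3 L) => Matrix.of fun (i j : Fin (fundamentalLatticeRep 2).N) => (((fun (V : GaugeConfig 3 L (Matrix.specialUnitaryGroup (Fin 2) ℂ)) (q : Edge 3 L × Fin (fundamentalLatticeRep 2).N × Fin (fundamentalLatticeRep 2).N × Bool) => (fun z : ℂ => if q.2.2.2 then z.im else z.re) ((fundamentalRep (Fin 2) (V q.1) : Matrix (Fin 2) (Fin 2) ℂ) q.2.1 q.2.2.1)) V (ee, i, j, false) : ℝ) : ℂ) + (((fun (V : GaugeConfig 3 L (Matrix.specialUnitaryGroup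 (Fin 2) ℂ)) (q : Edge 3 L × Fin (fundamentalLatticeRep 2).N × Fin (fundamentalLatticeRep 2).N × Bool) => (fun z : ℂ => if q.2.2.2 then z.im else z.re) ((fundamentalRep (Fin 2) (V q.1) : Matrix (Fin 2) (Fin 2) ℂ) q.2.1 q.2.2.1)) V (ee, i, j, true) : ℝ) : ℂ) * Complex.I) q.1)) q.2.1 q.2.2.1) else 0)
        ≤ K₀ * ∑ n : Edge 3 L × NoiseIdx (fundamentalLatticeRep 2).N, (Λ (fun q : Edge 3 L × Fin (fundamentalLatticeRep 2).N × Fin (fundamentalLatticeRep 2).N × Bool => if n.1 = q.1 then (fun z : ℂ => if q.2.2.2 then z.im else z.re) (((Real.sqrt 2 : ℂ) • ((fundamentalLatticeRep 2).lieProj (noiseDir n.2) * (fun (ee : Edge 3 L) => Matrix.of fun (i j : Fin (fundamentalLatticeRep 2).N) => (((fun (V : GaugeConfig 3 L (Matrix.specialUnitaryGroup (Fin 2) ℂ)) (q : Edge 3 L × Fin (fundamentalLatticeRep 2).N × Fin (fundamentalLatticeRep 2).N × Bool) => (fun z : ℂ => if q.2.2.2 then z.im else z.re) ((fundamentalRep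 (Fin 2) (V q.1) : Matrix (Fin 2) (Fin 2) ℂ) q.2.1 q.2.2.1)) V (ee, i, j, false) : ℝ) : ℂ) + (((fun (V : GaugeConfig 3 L (Matrix.specialUnitaryGroup (Fin 2) ℂ)) (q : Edge 3 L × Fin (fundamentalLatticeRep 2).N × Fin (fundamentalLatticeRep 2).N × Bool) => (fun z : ℂ => if q.2.2.2 then z.im else z.re) ((fundamentalRep (Fin 2) (V q.1) : Matrix (Fin 2) (Fin 2) ℂ) q.2.1 q.2.2.1)) V (ee, i, j, true) : ℝ) : ℂ) * Complex.I) q.1)) q.2.1 q.2.2.1) else 0)) ^ 2))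
    (Λ : Finset (Literature.MathematicalPhysics.QuantumLattice.ZdEdge 3)) (hinj : Set.InjOn (torusEdge (d := 3) L) ↑Λ)
    (f : (↥Λ → Matrix (Fin 2) (Fin 2) ℂ) → ℝ) (hf : ContDiff ℝ ∞ f) (ℓ : ↥Λ → ℝ) (hℓ : ∀ e, 0 ≤ ℓ e)
    (hLip : ∀ (e : ↥Λ) (M M' : ↥Λ → Matrix.specialUnitaryGroup (Fin 2) ℂ), (∀ e', e' ≠ e → M e' = M' e') →
      |f (fun e' => (M e' : Matrix (Fin 2) (Fin 2) ℂ)) - f (fun e' => (M' e' : Matrix (Fin 2) (Fin 2) ℂ))| ≤ ℓ e * suFrobDist (M e) (M' e))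
    (t : ℝ) :
    (∫ V, (t * matrixCylinder Λ f (torusLift L V)) * Real.exp (t * matrixCylinder Λ f (torusLift L V)) ∂(wilsonMeasure (d := 3) (L := L) (fundamentalRep (Fin 2)) β')) -
        (∫ V, Real.exp (t * matrixCylinder Λ f (torusLift L V)) ∂(wilsonMeasure (d := 3) (L := L) (fundamentalRep (Fin 2)) β')) *
          Real.log (∫ V, Real.exp (t * matrixCylinder Λ f (torusLift L V)) ∂(wilsonMeasure (d := 3) (L := L) (fundamentalRep (Fin 2)) β')) ≤
      (∑ e, ℓ e ^ 2) / (2 * (1 - K₀ / 2)) * t ^ 2 * ∫ V, Real.exp (t * matrixCylinder Λ f (torusLift L V)) ∂(wilsonMeasure (d := 3) (L := L) (fundamentalRep (Fin 2)) β') := by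
  classical
  set μ' : Measure (GaugeConfig 3 L (Matrix.specialUnitaryGroup (Fin 2) ℂ)) := (wilsonMeasure (d := 3) (L := L) (fundamentalRep (Fin 2)) β') with hμ'
  haveI : IsProbabilityMeasure μ' :=
    isProbabilityMeasure_wilsonMeasure (d := 3) (L := L) (fundamentalRep (Fin 2)) (continuous_fundamentalRep (Fin 2)) β'
  have hK1 : 0 < 1 - K₀ / 2 := by linarith
  set F : (GaugeConfig 3 L (Matrix.specialUnitaryGroup (Fin 2) ℂ)) → ℝ := fun V => matrixCylinder Λ f (torusLift L V) with hF
  have hres : Continuous fun V : (GaugeConfig 3 L (Matrix.specialUnitaryGroup (Fin 2) ℂ)) =>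
      (fun e' : ↥Λ => ((torusLift L V e'.1 : Matrix.specialUnitaryGroup (Fin 2) ℂ) : Matrix (Fin 2) (Fin 2) ℂ)) :=
    continuous_pi fun e => continuous_subtype_val.comp (continuous_apply _)
  have hFc : Continuous F := hf.continuous.comp hres
  have hfd : Differentiable ℝ f := hf.differentiable (by simp)
  have hN : (2 : ℕ) ≠ 0 := by norm_num
  set g : (↥Λ → Matrix (Fin 2) (Fin 2) ℂ) → ℝ := fun m => Real.exp (t / 2 * f m) with hg
  have hgC : ContDiff ℝ ∞ g := Real.contDiff_exp.comp (contDiff_const.mul hf)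
  have hLS := torus_entropy_le_sum_linkGradSq_of_hessBound L β' K₀ hK hHess Λ hinj g hgC
  have hG2 : ∀ V : (GaugeConfig 3 L (Matrix.specialUnitaryGroup (Fin 2) ℂ)), matrixCylinder Λ g (torusLift L V) ^ 2 = Real.exp (t * F V) := by
    intro V
    show Real.exp (t / 2 * f _) ^ 2 = Real.exp (t * f _)
    rw [sq, ← Real.exp_add]; ring_nf
  simp_rw [hG2, Real.log_exp] at hLS
  -- the link gradients of `g`
  have hgrad : ∀ (e : ↥Λ) (V : (GaugeConfig 3 L (Matrix.specialUnitaryGroup (Fin 2) ℂ))),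
      linkGradSq Λ g e (fun e' : ↥Λ => ((torusLift L V e'.1 : Matrix.specialUnitaryGroup (Fin 2) ℂ) : Matrix (Fin 2) (Fin 2) ℂ)) ≤
        (t / 2) ^ 2 * Real.exp (t * F V) * ℓ e ^ 2 := by
    intro e V
    have h1 := linkGradSq_exp_mul Λ hfd (t / 2) e
      (fun e' : ↥Λ => ((torusLift L V e'.1 : Matrix.specialUnitaryGroup (Fin 2) ℂ) : Matrix (Fin 2) (Fin 2) ℂ))
    have h2 := linkGradSq_le_sq_of_linkLipschitz hN Λ hfd e (hℓ e) (hLip e) (fun e' : ↥Λ => torusLift L V e'.1)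
    have hexp : Real.exp (t / 2 * f (fun e' : ↥Λ => ((torusLift L V e'.1 : Matrix.specialUnitaryGroup (Fin 2) ℂ) : Matrix (Fin 2) (Fin 2) ℂ))) ^ 2 =
        Real.exp (t * F V) := by
      show Real.exp (t / 2 * f _) ^ 2 = Real.exp (t * f _)
      rw [sq, ← Real.exp_add]; ring_nf
    have hge : linkGradSq Λ g e (fun e' : ↥Λ => ((torusLift L V e'.1 : Matrix.specialUnitaryGroup (Fin 2) ℂ) : Matrix (Fin 2) (Fin 2) ℂ)) =
        (t / 2) ^ 2 * Real.exp (t * F V) *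
          linkGradSq Λ f e (fun e' : ↥Λ => ((torusLift L V e'.1 : Matrix.specialUnitaryGroup (Fin 2) ℂ) : Matrix (Fin 2) (Fin 2) ℂ)) := by
      show linkGradSq Λ (fun m => Real.exp (t / 2 * f m)) e _ = _
      rw [h1, mul_pow, hexp]
    rw [hge]
    exact mul_le_mul_of_nonneg_left h2 (by positivity)
  -- integrate
  have hexpc : Continuous fun V => Real.exp (t * F V) := Real.continuous_exp.comp (continuous_const.mul hFc)
  have hexpi : Integrable (fun V => Real.exp (t * F V)) μ' := integrable_of_continuous_of_compactSpace hexpc _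
  have hsum_le : ∑ e : ↥Λ, ∫ V, linkGradSq Λ g e
        (fun e' : ↥Λ => ((torusLift L V e'.1 : Matrix.specialUnitaryGroup (Fin 2) ℂ) : Matrix (Fin 2) (Fin 2) ℂ)) ∂μ' ≤
      ∑ e : ↥Λ, (t / 2) ^ 2 * ℓ e ^ 2 * ∫ V, Real.exp (t * F V) ∂μ' := by
    refine Finset.sum_le_sum fun e _ => ?_
    have hgc : Continuous fun V : (GaugeConfig 3 L (Matrix.specialUnitaryGroup (Fin 2) ℂ)) =>
        linkGradSq Λ g e (fun e' : ↥Λ => ((torusLift L V e'.1 : Matrix.specialUnitaryGroup (Fin 2) ℂ) : Matrix (Fin 2) (Fin 2) ℂ)) :=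
      (continuous_linkGradSq Λ hgC e).comp hres
    calc ∫ V, linkGradSq Λ g e (fun e' : ↥Λ => ((torusLift L V e'.1 : Matrix.specialUnitaryGroup (Fin 2) ℂ) : Matrix (Fin 2) (Fin 2) ℂ)) ∂μ'
        ≤ ∫ V, (t / 2) ^ 2 * Real.exp (t * F V) * ℓ e ^ 2 ∂μ' :=
          integral_mono (integrable_of_continuous_of_compactSpace hgc _) ((hexpi.const_mul _).mul_const _) fun V => hgrad e V
      _ = (t / 2) ^ 2 * ℓ e ^ 2 * ∫ V, Real.exp (t * F V) ∂μ' := by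
          rw [← integral_const_mul]
          refine integral_congr_ae (ae_of_all _ fun V => ?_)
          ring
  calc (∫ V, (t * F V) * Real.exp (t * F V) ∂μ') - (∫ V, Real.exp (t * F V) ∂μ') * Real.log (∫ V, Real.exp (t * F V) ∂μ')
      = (∫ V, Real.exp (t * F V) * (t * F V) ∂μ') - (∫ V, Real.exp (t * F V) ∂μ') * Real.log (∫ V, Real.exp (t * F V) ∂μ') := by
        congr 1
        exact integral_congr_ae (ae_of_all _ fun V => mul_comm _ _)
    _ ≤ 2 * (∑ e : ↥Λ, ∫ V, linkGradSq Λ g e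
          (fun e' : ↥Λ => ((torusLift L V e'.1 : Matrix.specialUnitaryGroup (Fin 2) ℂ) : Matrix (Fin 2) (Fin 2) ℂ)) ∂μ') / (1 - K₀ / 2) := hLS
    _ ≤ 2 * (∑ e : ↥Λ, (t / 2) ^ 2 * ℓ e ^ 2 * ∫ V, Real.exp (t * F V) ∂μ') / (1 - K₀ / 2) :=
        div_le_div_of_nonneg_right (mul_le_mul_of_nonneg_left hsum_le (by norm_num)) hK1.le
    _ = (∑ e, ℓ e ^ 2) / (2 * (1 - K₀ / 2)) * t ^ 2 * ∫ V, Real.exp (t * F V) ∂μ' := by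
        rw [← Finset.sum_mul, ← Finset.mul_sum]
        have hKne : (1 - K₀ / 2) ≠ 0 := hK1.ne'
        field_simp

/-- **Laplace bound on the torus** under a frame-Hessian bound `K₀ < 2`: `μ_L(e^{λF}) ≤ exp(λ μ_L(F) + λ² Σ_e ℓ_e²/(2(1 − K₀/2)))`, `λ ≥ 0`,
for `F = f((U_e)_(e∈Λ)) ∘ torusLift` with `f` smooth and `ℓ_e`-Lipschitz in the link `e`. [cite: ShenZhuZhu2022, Corollary 4.4 (4.11)] -/
theorem torus_laplace_le_of_hessBound (L : ℕ) [NeZero L] (β' K₀ : ℝ) (hK : K₀ < 2)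
    (hHess : (∀ (V : (GaugeConfig 3 L (Matrix.specialUnitaryGroup (Fin 2) ℂ))) (Λ : (Edge 3 L × Fin (fundamentalLatticeRep 2).N × Fin (fundamentalLatticeRep 2).N × Bool → ℝ) →L[ℝ] ℝ),
      ∑ n : Edge 3 L × NoiseIdx (fundamentalLatticeRep 2).N, ∑ m : Edge 3 L × NoiseIdx (fundamentalLatticeRep 2).N,
        Λ ((fun q : Edge 3 L × Fin (fundamentalLatticeRep 2).N × Fin (fundamentalLatticeRep 2).N × Bool => if n.1 = q.1 then (fun z : ℂ => if q.2.2.2 then z.im else z.re) (((Real.sqrt 2 : ℂ) • ((fundamentalLatticeRep 2).lieProj (noiseDir n.2) * (fun (ee : Edge 3 L) => Matrix.of fun (i j : Fin (fundamentalLatticeRep 2).N) => (((fun (V : GaugeConfig 3 L (Matrix.specialUnitaryGroup (Fin 2) ℂ)) (q : Edge 3 L × Fin (fundamentalLatticeRep 2).N × Fin (fundamentalLatticeRep 2).N × Bool) => (fun z : ℂ => if q.2.2.2 then z.im else z.re) ((fundamentalRep (Fin 2) (V q.1) : Matrix (Fin 2) (Fin 2) ℂ) q.2.1 q.2.2.1))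 V (ee, i, j, false) : ℝ) : ℂ) + (((fun (V : GaugeConfig 3 L (Matrix.specialUnitaryGroup (Fin 2) ℂ)) (q : Edge 3 L × Fin (fundamentalLatticeRep 2).N × Fin (fundamentalLatticeRep 2).N × Bool) => (fun z : ℂ => if q.2.2.2 then z.im else z.re) ((fundamentalRep (Fin 2) (V q.1) : Matrix (Fin 2) (Fin 2) ℂ) q.2.1 q.2.2.1)) V (ee, i, j, true) : ℝ) : ℂ) * Complex.I) q.1)) q.2.1 q.2.2.1) else 0)) * Λ ((fun q : Edge 3 L × Fin (fundamentalLatticeRep 2).N × Fin (fundamentalLatticeRep 2).N × Bool => if m.1 = q.1 then (fun z : ℂ => if q.2.2.2 then z.im else z.re) (((Real.sqrt 2 : ℂ) • ((fundamentalLatticeRep 2).lieProj (noiseDir m.2) * (fun (ee : Edge 3 L) => Matrix.of fun (i j : Fin (fundamentalLatticeRep 2).N) => (((fun (V : GaugeConfig 3 L (Matrix.specialUnitaryGroup (Fin 2) ℂ)) (q : Edge 3 L × Fin (fundamentalLatticeRep 2).N × Fin (fundamentalLatticeRep 2).N × Bool) => (fun z : ℂ => if q.2.2.2 then z.im else z.re)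 ((fundamentalRep (Fin 2) (V q.1) : Matrix (Fin 2) (Fin 2) ℂ) q.2.1 q.2.2.1)) V (ee, i, j, false) : ℝ) : ℂ) + (((fun (V : GaugeConfig 3 L (Matrix.specialUnitaryGroup (Fin 2) ℂ)) (q : Edge 3 L × Fin (fundamentalLatticeRep 2).N × Fin (fundamentalLatticeRep 2).N × Bool) => (fun z : ℂ => if q.2.2.2 then z.im else z.re) ((fundamentalRep (Fin 2) (V q.1) : Matrix (Fin 2) (Fin 2) ℂ) q.2.1 q.2.2.1)) V (ee, i, j, true) : ℝ) : ℂ) * Complex.I) q.1)) q.2.1 q.2.2.1) else 0)) *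
          fderiv ℝ (fun z : (Edge 3 L × Fin (fundamentalLatticeRep 2).N × Fin (fundamentalLatticeRep 2).N × Bool → ℝ) => fderiv ℝ (fun y : (Edge 3 L × Fin (fundamentalLatticeRep 2).N × Fin (fundamentalLatticeRep 2).N × Bool → ℝ) => β' * ∑ p : Plaquette 3 L, (rootedLoop (fun (ee : Edge 3 L) (i j : Fin (fundamentalLatticeRep 2).N) => ((y (ee, i, j, false) : ℝ) : ℂ) + ((y (ee, i, j, true) : ℝ) : ℂ) * Complex.I) (p.1, p.2.1.1) p.2.1.2 false).trace.re) z (fun q : Edge 3 L × Fin (fundamentalLatticeRep 2).N × Fin (fundamentalLatticeRep 2).N × Bool => if m.1 = q.1 then (fun z : ℂ => if q.2.2.2 then z.im else z.re) (((Real.sqrt 2 : ℂ) • ((fundamentalLatticeRep 2).lieProj (noiseDir m.2) * (fun (ee : Edge 3 L) => Matrix.of fun (i j : Fin (fundamentalLatticeRep 2).N) => ((z (ee, i, j, false) : ℝ) : ℂ) + ((z (ee, i, j, true) : ℝ) : ℂ) * Complex.I) q.1)) q.2.1 q.2.2.1) else 0)) ((fun (V : GaugeConfig 3 L (Matrix.specialUnitaryGroup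 (Fin 2) ℂ)) (q : Edge 3 L × Fin (fundamentalLatticeRep 2).N × Fin (fundamentalLatticeRep 2).N × Bool) => (fun z : ℂ => if q.2.2.2 then z.im else z.re) ((fundamentalRep (Fin 2) (V q.1) : Matrix (Fin 2) (Fin 2) ℂ) q.2.1 q.2.2.1)) V) (fun q : Edge 3 L × Fin (fundamentalLatticeRep 2).N × Fin (fundamentalLatticeRep 2).N × Bool => if n.1 = q.1 then (fun z : ℂ => if q.2.2.2 then z.im else z.re) (((Real.sqrt 2 : ℂ) • ((fundamentalLatticeRep 2).lieProj (noiseDir n.2) * (fun (ee : Edge 3 L) => Matrix.of fun (i j : Fin (fundamentalLatticeRep 2).N) => (((fun (V : GaugeConfig 3 L (Matrix.specialUnitaryGroup (Fin 2) ℂ)) (q : Edge 3 L × Fin (fundamentalLatticeRep 2).N × Fin (fundamentalLatticeRep 2).N × Bool) => (fun z : ℂ => if q.2.2.2 then z.im else z.re) ((fundamentalRep (Fin 2) (V q.1) : Matrix (Fin 2) (Fin 2) ℂ) q.2.1 q.2.2.1)) V (ee, i, j, false) : ℝ) : ℂ) + (((fun (V : GaugeConfig 3 L (Matrix.specialUnitaryGroup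 (Fin 2) ℂ)) (q : Edge 3 L × Fin (fundamentalLatticeRep 2).N × Fin (fundamentalLatticeRep 2).N × Bool) => (fun z : ℂ => if q.2.2.2 then z.im else z.re) ((fundamentalRep (Fin 2) (V q.1) : Matrix (Fin 2) (Fin 2) ℂ) q.2.1 q.2.2.1)) V (ee, i, j, true) : ℝ) : ℂ) * Complex.I) q.1)) q.2.1 q.2.2.1) else 0)
        ≤ K₀ * ∑ n : Edge 3 L × NoiseIdx (fundamentalLatticeRep 2).N, (Λ (fun q : Edge 3 L × Fin (fundamentalLatticeRep 2).N × Fin (fundamentalLatticeRep 2).N × Bool => if n.1 = q.1 then (fun z : ℂ => if q.2.2.2 then z.im else z.re) (((Real.sqrt 2 : ℂ) • ((fundamentalLatticeRep 2).lieProj (noiseDir n.2) * (fun (ee : Edge 3 L) => Matrix.of fun (i j : Fin (fundamentalLatticeRep 2).N) => (((fun (V : GaugeConfig 3 L (Matrix.specialUnitaryGroup (Fin 2) ℂ)) (q : Edge 3 L × Fin (fundamentalLatticeRep 2).N × Fin (fundamentalLatticeRep 2).N × Bool) => (fun z : ℂ => if q.2.2.2 then z.im else z.re) ((fundamentalRep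 (Fin 2) (V q.1) : Matrix (Fin 2) (Fin 2) ℂ) q.2.1 q.2.2.1)) V (ee, i, j, false) : ℝ) : ℂ) + (((fun (V : GaugeConfig 3 L (Matrix.specialUnitaryGroup (Fin 2) ℂ)) (q : Edge 3 L × Fin (fundamentalLatticeRep 2).N × Fin (fundamentalLatticeRep 2).N × Bool) => (fun z : ℂ => if q.2.2.2 then z.im else z.re) ((fundamentalRep (Fin 2) (V q.1) : Matrix (Fin 2) (Fin 2) ℂ) q.2.1 q.2.2.1)) V (ee, i, j, true) : ℝ) : ℂ) * Complex.I) q.1)) q.2.1 q.2.2.1) else 0)) ^ 2))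
    (Λ : Finset (Literature.MathematicalPhysics.QuantumLattice.ZdEdge 3)) (hinj : Set.InjOn (torusEdge (d := 3) L) ↑Λ)
    (f : (↥Λ → Matrix (Fin 2) (Fin 2) ℂ) → ℝ) (hf : ContDiff ℝ ∞ f) (ℓ : ↥Λ → ℝ) (hℓ : ∀ e, 0 ≤ ℓ e)
    (hLip : ∀ (e : ↥Λ) (M M' : ↥Λ → Matrix.specialUnitaryGroup (Fin 2) ℂ), (∀ e', e' ≠ e → M e' = M' e') →
      |f (fun e' => (M e' : Matrix (Fin 2) (Fin 2) ℂ)) - f (fun e' => (M' e' : Matrix (Fin 2) (Fin 2) ℂ))| ≤ ℓ e * suFrobDist (M e) (M' e))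
    {l : ℝ} (hl : 0 ≤ l) :
    ∫ V, Real.exp (l * matrixCylinder Λ f (torusLift L V)) ∂(wilsonMeasure (d := 3) (L := L) (fundamentalRep (Fin 2)) β') ≤
      Real.exp (l * (∫ V, matrixCylinder Λ f (torusLift L V) ∂(wilsonMeasure (d := 3) (L := L) (fundamentalRep (Fin 2)) β')) + (∑ e, ℓ e ^ 2) / (2 * (1 - K₀ / 2)) * l ^ 2) := by
  classical
  set μ' : Measure (GaugeConfig 3 L (Matrix.specialUnitaryGroup (Fin 2) ℂ)) := (wilsonMeasure (d := 3) (L := L) (fundamentalRep (Fin 2)) β') with hμ'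
  haveI : IsProbabilityMeasure μ' :=
    isProbabilityMeasure_wilsonMeasure (d := 3) (L := L) (fundamentalRep (Fin 2)) (continuous_fundamentalRep (Fin 2)) β'
  set F : (GaugeConfig 3 L (Matrix.specialUnitaryGroup (Fin 2) ℂ)) → ℝ := fun V => matrixCylinder Λ f (torusLift L V) with hF
  have hres : Continuous fun V : (GaugeConfig 3 L (Matrix.specialUnitaryGroup (Fin 2) ℂ)) =>
      (fun e' : ↥Λ => ((torusLift L V e'.1 : Matrix.specialUnitaryGroup (Fin 2) ℂ) : Matrix (Fin 2) (Fin 2) ℂ)) :=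
    continuous_pi fun e => continuous_subtype_val.comp (continuous_apply _)
  have hFc : Continuous F := hf.continuous.comp hres
  have hFm : Measurable F := hFc.measurable
  obtain ⟨C, hC⟩ : ∃ C, ∀ V, |F V| ≤ C := by
    obtain ⟨C, hC⟩ := (isCompact_univ (X := (GaugeConfig 3 L (Matrix.specialUnitaryGroup (Fin 2) ℂ)))).exists_bound_of_continuousOn hFc.continuousOn
    exact ⟨C, fun V => by simpa [Real.norm_eq_abs] using hC V (Set.mem_univ _)⟩
  have hEnt : ∀ t : ℝ, 0 < t →
      (∫ V, (t * F V) * Real.exp (t * F V) ∂μ') - (∫ V, Real.exp (t * F V) ∂μ') * Real.log (∫ V, Real.exp (t * F V) ∂μ') ≤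
        (∑ e, ℓ e ^ 2) / (2 * (1 - K₀ / 2)) * t ^ 2 * ∫ V, Real.exp (t * F V) ∂μ' :=
    fun t _ => torus_herbst_entropy_of_hessBound L β' K₀ hK hHess Λ hinj f hf ℓ hℓ hLip t
  exact integral_exp_mul_le_of_entropy_le μ' hFm hC hEnt hl

/-- **Gaussian concentration on the torus** under a frame-Hessian bound `K₀ < 2`: for `F = f((U_e)_(e∈Λ)) ∘ torusLift` with `f` smooth and
`ℓ_e`-Lipschitz in the link `e`, `Σ_e ℓ_e² > 0`, and `r ≥ 0`: `μ_L{μ_L(F) + r ≤ F} ≤ exp(−(1 − K₀/2) r²/(2 Σ_e ℓ_e²))`.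
[cite: ShenZhuZhu2022, Corollary 4.4 (4.11)] -/
theorem torus_concentration_of_hessBound (L : ℕ) [NeZero L] (β' K₀ : ℝ) (hK : K₀ < 2)
    (hHess : (∀ (V : (GaugeConfig 3 L (Matrix.specialUnitaryGroup (Fin 2) ℂ))) (Λ : (Edge 3 L × Fin (fundamentalLatticeRep 2).N × Fin (fundamentalLatticeRep 2).N × Bool → ℝ) →L[ℝ] ℝ),
      ∑ n : Edge 3 L × NoiseIdx (fundamentalLatticeRep 2).N, ∑ m : Edge 3 L × NoiseIdx (fundamentalLatticeRep 2).N,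
        Λ ((fun q : Edge 3 L × Fin (fundamentalLatticeRep 2).N × Fin (fundamentalLatticeRep 2).N × Bool => if n.1 = q.1 then (fun z : ℂ => if q.2.2.2 then z.im else z.re) (((Real.sqrt 2 : ℂ) • ((fundamentalLatticeRep 2).lieProj (noiseDir n.2) * (fun (ee : Edge 3 L) => Matrix.of fun (i j : Fin (fundamentalLatticeRep 2).N) => (((fun (V : GaugeConfig 3 L (Matrix.specialUnitaryGroup (Fin 2) ℂ)) (q : Edge 3 L × Fin (fundamentalLatticeRep 2).N × Fin (fundamentalLatticeRep 2).N × Bool) => (fun z : ℂ => if q.2.2.2 then z.im else z.re) ((fundamentalRep (Fin 2) (V q.1) : Matrix (Fin 2) (Fin 2) ℂ) q.2.1 q.2.2.1)) V (ee, i, j, false) : ℝ) : ℂ) + (((fun (V : GaugeConfig 3 L (Matrix.specialUnitaryGroup (Fin 2) ℂ)) (q : Edge 3 L × Fin (fundamentalLatticeRep 2).N × Fin (fundamentalLatticeRep 2).N × Bool) => (fun z : ℂ => if q.2.2.2 then z.im else z.re) ((fundamentalRep (Fin 2) (V q.1) : Matrix (Fin 2) (Fin 2) ℂ) q.2.1 q.2.2.1))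 V (ee, i, j, true) : ℝ) : ℂ) * Complex.I) q.1)) q.2.1 q.2.2.1) else 0)) * Λ ((fun q : Edge 3 L × Fin (fundamentalLatticeRep 2).N × Fin (fundamentalLatticeRep 2).N × Bool => if m.1 = q.1 then (fun z : ℂ => if q.2.2.2 then z.im else z.re) (((Real.sqrt 2 : ℂ) • ((fundamentalLatticeRep 2).lieProj (noiseDir m.2) * (fun (ee : Edge 3 L) => Matrix.of fun (i j : Fin (fundamentalLatticeRep 2).N) => (((fun (V : GaugeConfig 3 L (Matrix.specialUnitaryGroup (Fin 2) ℂ)) (q : Edge 3 L × Fin (fundamentalLatticeRep 2).N × Fin (fundamentalLatticeRep 2).N × Bool) => (fun z : ℂ => if q.2.2.2 then z.im else z.re) ((fundamentalRep (Fin 2) (V q.1) : Matrix (Fin 2) (Fin 2) ℂ) q.2.1 q.2.2.1)) V (ee, i, j, false) : ℝ) : ℂ) + (((fun (V : GaugeConfig 3 L (Matrix.specialUnitaryGroup (Fin 2) ℂ)) (q : Edge 3 L × Fin (fundamentalLatticeRep 2).N × Fin (fundamentalLatticeRep 2).N × Bool) => (fun z : ℂ => if q.2.2.2 then z.im else z.re)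 ((fundamentalRep (Fin 2) (V q.1) : Matrix (Fin 2) (Fin 2) ℂ) q.2.1 q.2.2.1)) V (ee, i, j, true) : ℝ) : ℂ) * Complex.I) q.1)) q.2.1 q.2.2.1) else 0)) *
          fderiv ℝ (fun z : (Edge 3 L × Fin (fundamentalLatticeRep 2).N × Fin (fundamentalLatticeRep 2).N × Bool → ℝ) => fderiv ℝ (fun y : (Edge 3 L × Fin (fundamentalLatticeRep 2).N × Fin (fundamentalLatticeRep 2).N × Bool → ℝ) => β' * ∑ p : Plaquette 3 L, (rootedLoop (fun (ee : Edge 3 L) (i j : Fin (fundamentalLatticeRep 2).N) => ((y (ee, i, j, false) : ℝ) : ℂ) + ((y (ee, i, j, true) : ℝ) : ℂ) * Complex.I) (p.1, p.2.1.1) p.2.1.2 false).trace.re) z (fun q : Edge 3 L × Fin (fundamentalLatticeRep 2).N × Fin (fundamentalLatticeRep 2).N × Bool => if m.1 = q.1 then (fun z : ℂ => if q.2.2.2 then z.im else z.re) (((Real.sqrt 2 : ℂ) • ((fundamentalLatticeRep 2).lieProj (noiseDir m.2) * (fun (ee : Edge 3 L) => Matrix.of fun (i j : Fin (fundamentalLatticeRep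 2).N) => ((z (ee, i, j, false) : ℝ) : ℂ) + ((z (ee, i, j, true) : ℝ) : ℂ) * Complex.I) q.1)) q.2.1 q.2.2.1) else 0)) ((fun (V : GaugeConfig 3 L (Matrix.specialUnitaryGroup (Fin 2) ℂ)) (q : Edge 3 L × Fin (fundamentalLatticeRep 2).N × Fin (fundamentalLatticeRep 2).N × Bool) => (fun z : ℂ => if q.2.2.2 then z.im else z.re) ((fundamentalRep (Fin 2) (V q.1) : Matrix (Fin 2) (Fin 2) ℂ) q.2.1 q.2.2.1)) V) (fun q : Edge 3 L × Fin (fundamentalLatticeRep 2).N × Fin (fundamentalLatticeRep 2).N × Bool => if n.1 = q.1 then (fun z : ℂ => if q.2.2.2 then z.im else z.re) (((Real.sqrt 2 : ℂ) • ((fundamentalLatticeRep 2).lieProj (noiseDir n.2) * (fun (ee : Edge 3 L) => Matrix.of fun (i j : Fin (fundamentalLatticeRep 2).N) => (((fun (V : GaugeConfig 3 L (Matrix.specialUnitaryGroup (Fin 2) ℂ)) (q : Edge 3 L × Fin (fundamentalLatticeRep 2).N × Fin (fundamentalLatticeRep 2).N × Bool) => (fun z : ℂ => if q.2.2.2 then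 z.im else z.re) ((fundamentalRep (Fin 2) (V q.1) : Matrix (Fin 2) (Fin 2) ℂ) q.2.1 q.2.2.1)) V (ee, i, j, false) : ℝ) : ℂ) + (((fun (V : GaugeConfig 3 L (Matrix.specialUnitaryGroup (Fin 2) ℂ)) (q : Edge 3 L × Fin (fundamentalLatticeRep 2).N × Fin (fundamentalLatticeRep 2).N × Bool) => (fun z : ℂ => if q.2.2.2 then z.im else z.re) ((fundamentalRep (Fin 2) (V q.1) : Matrix (Fin 2) (Fin 2) ℂ) q.2.1 q.2.2.1)) V (ee, i, j, true) : ℝ) : ℂ) * Complex.I) q.1)) q.2.1 q.2.2.1) else 0)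
        ≤ K₀ * ∑ n : Edge 3 L × NoiseIdx (fundamentalLatticeRep 2).N, (Λ (fun q : Edge 3 L × Fin (fundamentalLatticeRep 2).N × Fin (fundamentalLatticeRep 2).N × Bool => if n.1 = q.1 then (fun z : ℂ => if q.2.2.2 then z.im else z.re) (((Real.sqrt 2 : ℂ) • ((fundamentalLatticeRep 2).lieProj (noiseDir n.2) * (fun (ee : Edge 3 L) => Matrix.of fun (i j : Fin (fundamentalLatticeRep 2).N) => (((fun (V : GaugeConfig 3 L (Matrix.specialUnitaryGroup (Fin 2) ℂ)) (q : Edge 3 L × Fin (fundamentalLatticeRep 2).N × Fin (fundamentalLatticeRep 2).N × Bool) => (fun z : ℂ => if q.2.2.2 then z.im else z.re) ((fundamentalRep (Fin 2) (V q.1) : Matrix (Fin 2) (Fin 2) ℂ) q.2.1 q.2.2.1)) V (ee, i, j, false) : ℝ) : ℂ) + (((fun (V : GaugeConfig 3 L (Matrix.specialUnitaryGroup (Fin 2) ℂ)) (q : Edge 3 L × Fin (fundamentalLatticeRep 2).N × Fin (fundamentalLatticeRep 2).N × Bool) => (fun z : ℂ => if q.2.2.2 then z.im else z.re) ((fundamentalRep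 (Fin 2) (V q.1) : Matrix (Fin 2) (Fin 2) ℂ) q.2.1 q.2.2.1)) V (ee, i, j, true) : ℝ) : ℂ) * Complex.I) q.1)) q.2.1 q.2.2.1) else 0)) ^ 2))
    (Λ : Finset (Literature.MathematicalPhysics.QuantumLattice.ZdEdge 3)) (hinj : Set.InjOn (torusEdge (d := 3) L) ↑Λ)
    (f : (↥Λ → Matrix (Fin 2) (Fin 2) ℂ) → ℝ) (hf : ContDiff ℝ ∞ f) (ℓ : ↥Λ → ℝ) (hℓ : ∀ e, 0 ≤ ℓ e) (hS : 0 < ∑ e, ℓ e ^ 2)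
    (hLip : ∀ (e : ↥Λ) (M M' : ↥Λ → Matrix.specialUnitaryGroup (Fin 2) ℂ), (∀ e', e' ≠ e → M e' = M' e') →
      |f (fun e' => (M e' : Matrix (Fin 2) (Fin 2) ℂ)) - f (fun e' => (M' e' : Matrix (Fin 2) (Fin 2) ℂ))| ≤ ℓ e * suFrobDist (M e) (M' e))
    {r : ℝ} (hr : 0 ≤ r) :
    ((wilsonMeasure (d := 3) (L := L) (fundamentalRep (Fin 2)) β')).real {V | (∫ V', matrixCylinder Λ f (torusLift L V') ∂(wilsonMeasure (d := 3) (L := L) (fundamentalRep (Fin 2)) β')) + r ≤ matrixCylinder Λ f (torusLift L V)} ≤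
      Real.exp (-((1 - K₀ / 2) * r ^ 2 / (2 * ∑ e, ℓ e ^ 2))) := by
  classical
  set μ' : Measure (GaugeConfig 3 L (Matrix.specialUnitaryGroup (Fin 2) ℂ)) := (wilsonMeasure (d := 3) (L := L) (fundamentalRep (Fin 2)) β') with hμ'
  haveI : IsProbabilityMeasure μ' :=
    isProbabilityMeasure_wilsonMeasure (d := 3) (L := L) (fundamentalRep (Fin 2)) (continuous_fundamentalRep (Fin 2)) β'
  have hK1 : 0 < 1 - K₀ / 2 := by linarith
  set F : (GaugeConfig 3 L (Matrix.specialUnitaryGroup (Fin 2) ℂ)) → ℝ := fun V => matrixCylinder Λ f (torusLift L V) with hF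
  have hres : Continuous fun V : (GaugeConfig 3 L (Matrix.specialUnitaryGroup (Fin 2) ℂ)) =>
      (fun e' : ↥Λ => ((torusLift L V e'.1 : Matrix.specialUnitaryGroup (Fin 2) ℂ) : Matrix (Fin 2) (Fin 2) ℂ)) :=
    continuous_pi fun e => continuous_subtype_val.comp (continuous_apply _)
  have hFc : Continuous F := hf.continuous.comp hres
  have hFm : Measurable F := hFc.measurable
  obtain ⟨C, hC⟩ : ∃ C, ∀ V, |F V| ≤ C := by
    obtain ⟨C, hC⟩ := (isCompact_univ (X := (GaugeConfig 3 L (Matrix.specialUnitaryGroup (Fin 2) ℂ)))).exists_bound_of_continuousOn hFc.continuousOn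
    exact ⟨C, fun V => by simpa [Real.norm_eq_abs] using hC V (Set.mem_univ _)⟩
  set κ : ℝ := (∑ e, ℓ e ^ 2) / (2 * (1 - K₀ / 2)) with hκ
  have hκpos : 0 < κ := by rw [hκ]; positivity
  have hEnt : ∀ t : ℝ, 0 < t →
      (∫ V, (t * F V) * Real.exp (t * F V) ∂μ') - (∫ V, Real.exp (t * F V) ∂μ') * Real.log (∫ V, Real.exp (t * F V) ∂μ') ≤
        κ * t ^ 2 * ∫ V, Real.exp (t * F V) ∂μ' :=
    fun t _ => torus_herbst_entropy_of_hessBound L β' K₀ hK hHess Λ hinj f hf ℓ hℓ hLip t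
  have h := measureReal_ge_le_exp_of_entropy_le μ' hFm hC hκpos hEnt hr
  have hexp_eq : r ^ 2 / (4 * κ) = (1 - K₀ / 2) * r ^ 2 / (2 * ∑ e, ℓ e ^ 2) := by
    rw [hκ]
    have hKne : (1 - K₀ / 2) ≠ 0 := hK1.ne'
    have hSne : (∑ e, ℓ e ^ 2) ≠ 0 := hS.ne'
    field_simp
    ring
  rw [hexp_eq] at h
  exact h

/-! ## §2. `|β'| < 1/12`: the same bounds in every volume -/

/-- ★★★ **Gaussian concentration of Lipschitz cylinder observables on every torus, uniformly in the volume, `|β'| < 1/12`.**  For the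
periodic `SU(2)` Wilson measure on `(ℤ/L)³` at tree coupling `β'` with `|β'| < 1/12` (frame-Hessian bound `K₀ = 24|β'|`, `wilson_hessBound`),
EVERY `L ≥ 1`, every finite `Λ ⊆ E⁺(ℤ³)` mapped injectively to the torus, every smooth `f` that is `ℓ_e`-Lipschitz in the link `e` with
`Σ_e ℓ_e² > 0`, and every `r ≥ 0`: `μ_{L,β'}{⟨F⟩ + r ≤ F} ≤ exp(−(1 − 12|β'|) r²/(2 Σ_e ℓ_e²))`, `F = f((U_e)_(e∈Λ)) ∘ torusLift` — a bound
that does not depend on `L`.  Strong coupling, fixed lattice; the Yang–Mills mass gap is NOT proved. [cite: ShenZhuZhu2022, Corollary 4.4 (4.11), Theorem 1.4] -/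
theorem torus_concentration_su2_uniform {β' : ℝ} (hβ : |β'| < 1 / 12) (L : ℕ) [NeZero L]
    (Λ : Finset (Literature.MathematicalPhysics.QuantumLattice.ZdEdge 3)) (hinj : Set.InjOn (torusEdge (d := 3) L) ↑Λ)
    (f : (↥Λ → Matrix (Fin 2) (Fin 2) ℂ) → ℝ) (hf : ContDiff ℝ ∞ f) (ℓ : ↥Λ → ℝ) (hℓ : ∀ e, 0 ≤ ℓ e) (hS : 0 < ∑ e, ℓ e ^ 2)
    (hLip : ∀ (e : ↥Λ) (M M' : ↥Λ → Matrix.specialUnitaryGroup (Fin 2) ℂ), (∀ e', e' ≠ e → M e' = M' e') →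
      |f (fun e' => (M e' : Matrix (Fin 2) (Fin 2) ℂ)) - f (fun e' => (M' e' : Matrix (Fin 2) (Fin 2) ℂ))| ≤ ℓ e * suFrobDist (M e) (M' e))
    {r : ℝ} (hr : 0 ≤ r) :
    ((wilsonMeasure (d := 3) (L := L) (fundamentalRep (Fin 2)) β')).real {V | (∫ V', matrixCylinder Λ f (torusLift L V') ∂(wilsonMeasure (d := 3) (L := L) (fundamentalRep (Fin 2)) β')) + r ≤ matrixCylinder Λ f (torusLift L V)} ≤
      Real.exp (-((1 - 12 * |β'|) * r ^ 2 / (2 * ∑ e, ℓ e ^ 2))) := by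
  have hK : 24 * |β'| < 2 := by linarith
  have h := torus_concentration_of_hessBound L β' (24 * |β'|) hK (wilson_hessBound L β') Λ hinj f hf ℓ hℓ hS hLip hr
  have e : 1 - 24 * |β'| / 2 = 1 - 12 * |β'| := by ring
  rw [e] at h
  exact h

/-- **Laplace bound on every torus, uniformly in the volume, `|β'| < 1/12`**: `μ_{L,β'}(e^{λF}) ≤ exp(λ⟨F⟩ + λ² Σ_e ℓ_e²/(2(1 − 12|β'|)))`,
`λ ≥ 0`.  The Yang–Mills mass gap is NOT proved. [cite: ShenZhuZhu2022, Corollary 4.4 (4.11), Theorem 1.4] -/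
theorem torus_laplace_su2_uniform {β' : ℝ} (hβ : |β'| < 1 / 12) (L : ℕ) [NeZero L]
    (Λ : Finset (Literature.MathematicalPhysics.QuantumLattice.ZdEdge 3)) (hinj : Set.InjOn (torusEdge (d := 3) L) ↑Λ)
    (f : (↥Λ → Matrix (Fin 2) (Fin 2) ℂ) → ℝ) (hf : ContDiff ℝ ∞ f) (ℓ : ↥Λ → ℝ) (hℓ : ∀ e, 0 ≤ ℓ e)
    (hLip : ∀ (e : ↥Λ) (M M' : ↥Λ → Matrix.specialUnitaryGroup (Fin 2) ℂ), (∀ e', e' ≠ e → M e' = M' e') →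
      |f (fun e' => (M e' : Matrix (Fin 2) (Fin 2) ℂ)) - f (fun e' => (M' e' : Matrix (Fin 2) (Fin 2) ℂ))| ≤ ℓ e * suFrobDist (M e) (M' e))
    {l : ℝ} (hl : 0 ≤ l) :
    ∫ V, Real.exp (l * matrixCylinder Λ f (torusLift L V)) ∂(wilsonMeasure (d := 3) (L := L) (fundamentalRep (Fin 2)) β') ≤
      Real.exp (l * (∫ V, matrixCylinder Λ f (torusLift L V) ∂(wilsonMeasure (d := 3) (L := L) (fundamentalRep (Fin 2)) β')) + (∑ e, ℓ e ^ 2) / (2 * (1 - 12 * |β'|)) * l ^ 2) := by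
  have hK : 24 * |β'| < 2 := by linarith
  have h := torus_laplace_le_of_hessBound L β' (24 * |β'|) hK (wilson_hessBound L β') Λ hinj f hf ℓ hℓ hLip hl
  have e : 1 - 24 * |β'| / 2 = 1 - 12 * |β'| := by ring
  rw [e] at h
  exact h

/-! ## §3. Wilson loops on the torus -/

/-- ★★★ **Gaussian concentration of Wilson loops on every torus, uniformly in the volume, `|β'| < 1/12`.**  For the periodic `SU(2)` Wilson
measure on `(ℤ/L)³` at tree coupling `|β'| < 1/12`, every closed lattice walk `C` in `ℤ³` of positive length whose links are distinct on the torus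
(`torusEdge L` injective on `links(C)` — every fixed `C` once `L` exceeds its diameter), read through the periodic lift, and every `r ≥ 0`:
`μ_{L,β'}{|W_C − ⟨W_C⟩| ≥ r} ≤ 2 exp(−(1 − 12|β'|) r²/Σ_{e ∈ links(C)} mult_C(e)²)`, `W_C = ½ Re tr hol_C`.  Strong coupling, fixed lattice; the
Yang–Mills mass gap is NOT proved. [cite: ShenZhuZhu2022, Theorem 1.4, Corollary 1.5] -/
theorem torus_wilsonLoop_twoSided_su2_uniform {β' : ℝ} (hβ : |β'| < 1 / 12) (L : ℕ) [NeZero L]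
    {x : Site 3} (w : (zdGraph 3).Walk x x) (hinj : Set.InjOn (torusEdge (d := 3) L) ↑(walkEdges w)) (hw : 0 < w.length)
    {r : ℝ} (hr : 0 ≤ r) :
    ((wilsonMeasure (d := 3) (L := L) (fundamentalRep (Fin 2)) β')).real {V | r ≤ |wilsonLoopObs (fun g : Matrix.specialUnitaryGroup (Fin 2) ℂ => normalisedCharacter 2 (fundamentalRep (Fin 2) g)) w
          (torusLift L V) -
        ∫ V', wilsonLoopObs (fun g : Matrix.specialUnitaryGroup (Fin 2) ℂ => normalisedCharacter 2 (fundamentalRep (Fin 2) g)) w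
          (torusLift L V') ∂(wilsonMeasure (d := 3) (L := L) (fundamentalRep (Fin 2)) β')|} ≤
      2 * Real.exp (-((1 - 12 * |β'|) * r ^ 2 / ∑ e ∈ walkEdges w, (dartMult w e : ℝ) ^ 2)) := by
  classical
  set μ' : Measure (GaugeConfig 3 L (Matrix.specialUnitaryGroup (Fin 2) ℂ)) := (wilsonMeasure (d := 3) (L := L) (fundamentalRep (Fin 2)) β') with hμ'
  haveI : IsProbabilityMeasure μ' :=
    isProbabilityMeasure_wilsonMeasure (d := 3) (L := L) (fundamentalRep (Fin 2)) (continuous_fundamentalRep (Fin 2)) β'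
  set χ : Matrix.specialUnitaryGroup (Fin 2) ℂ → ℝ := fun g => normalisedCharacter 2 (fundamentalRep (Fin 2) g) with hχ
  obtain ⟨f, hf, hrep, hLip⟩ := exists_smooth_linkLipschitz_wilsonLoopObs (N := 2) w
  set ℓ : ↥(walkEdges w) → ℝ := fun e =>
    (dartMult w (e : Literature.MathematicalPhysics.QuantumLattice.ZdEdge 3) : ℝ) / Real.sqrt ((2 : ℕ) : ℝ) with hℓdef
  have hℓ : ∀ e, 0 ≤ ℓ e := fun e => div_nonneg (Nat.cast_nonneg _) (Real.sqrt_nonneg _)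
  have hsum : 2 * ∑ e, ℓ e ^ 2 = ∑ e ∈ walkEdges w, (dartMult w e : ℝ) ^ 2 := by
    have h2 : Real.sqrt ((2 : ℕ) : ℝ) ^ 2 = 2 := by rw [Real.sq_sqrt (Nat.cast_nonneg _)]; norm_num
    simp only [hℓdef, div_pow, h2]
    rw [← Finset.sum_div, Finset.sum_coe_sort (walkEdges w) (fun e => (dartMult w e : ℝ) ^ 2)]
    ring
  have hS : 0 < ∑ e, ℓ e ^ 2 := by
    have h1 := length_le_sum_dartMult_sq w
    have h0 : (0 : ℝ) < w.length := by exact_mod_cast hw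
    linarith
  -- upper tail
  have hF : ∀ V : (GaugeConfig 3 L (Matrix.specialUnitaryGroup (Fin 2) ℂ)), matrixCylinder (walkEdges w) f (torusLift L V) = wilsonLoopObs χ w (torusLift L V) := fun V => hrep _
  have hup := torus_concentration_su2_uniform hβ L (walkEdges w) hinj f hf ℓ hℓ hS hLip hr
  simp_rw [hF] at hup
  rw [hsum] at hup
  -- lower tail, through `-f`
  have hf' : ContDiff ℝ ∞ (fun m => - f m) := hf.neg
  have hLip' : ∀ (e : ↥(walkEdges w)) (M M' : ↥(walkEdges w) → Matrix.specialUnitaryGroup (Fin 2) ℂ),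
      (∀ e', e' ≠ e → M e' = M' e') →
      |(fun m => - f m) (fun e' => (M e' : Matrix (Fin 2) (Fin 2) ℂ)) -
          (fun m => - f m) (fun e' => (M' e' : Matrix (Fin 2) (Fin 2) ℂ))| ≤ ℓ e * suFrobDist (M e) (M' e) := by
    intro e M M' h
    simp only [neg_sub_neg]
    rw [abs_sub_comm]
    exact hLip e M M' h
  have hF' : ∀ V : (GaugeConfig 3 L (Matrix.specialUnitaryGroup (Fin 2) ℂ)), matrixCylinder (walkEdges w) (fun m => - f m) (torusLift L V) = - wilsonLoopObs χ w (torusLift L V) := by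
    intro V; rw [← hrep (torusLift L V)]; rfl
  have hlow := torus_concentration_su2_uniform hβ L (walkEdges w) hinj (fun m => - f m) hf' ℓ hℓ hS hLip' hr
  simp_rw [hF'] at hlow
  rw [hsum, integral_neg] at hlow
  -- union bound
  have hsub : {V : (GaugeConfig 3 L (Matrix.specialUnitaryGroup (Fin 2) ℂ)) | r ≤ |wilsonLoopObs χ w (torusLift L V) - ∫ V', wilsonLoopObs χ w (torusLift L V') ∂μ'|} ⊆
      {V | (∫ V', wilsonLoopObs χ w (torusLift L V') ∂μ') + r ≤ wilsonLoopObs χ w (torusLift L V)} ∪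
        {V | -(∫ V', wilsonLoopObs χ w (torusLift L V') ∂μ') + r ≤ - wilsonLoopObs χ w (torusLift L V)} := by
    intro V hV
    simp only [mem_setOf_eq, mem_union] at hV ⊢
    rcases le_abs'.1 hV with h | h
    · right; linarith
    · left; linarith
  calc μ'.real {V : (GaugeConfig 3 L (Matrix.specialUnitaryGroup (Fin 2) ℂ)) | r ≤ |wilsonLoopObs χ w (torusLift L V) - ∫ V', wilsonLoopObs χ w (torusLift L V') ∂μ'|}
      ≤ μ'.real ({V | (∫ V', wilsonLoopObs χ w (torusLift L V') ∂μ') + r ≤ wilsonLoopObs χ w (torusLift L V)} ∪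
          {V | -(∫ V', wilsonLoopObs χ w (torusLift L V') ∂μ') + r ≤ - wilsonLoopObs χ w (torusLift L V)}) := measureReal_mono hsub
    _ ≤ μ'.real {V | (∫ V', wilsonLoopObs χ w (torusLift L V') ∂μ') + r ≤ wilsonLoopObs χ w (torusLift L V)} +
          μ'.real {V | -(∫ V', wilsonLoopObs χ w (torusLift L V') ∂μ') + r ≤ - wilsonLoopObs χ w (torusLift L V)} :=
        measureReal_union_le _ _
    _ ≤ Real.exp (-((1 - 12 * |β'|) * r ^ 2 / ∑ e ∈ walkEdges w, (dartMult w e : ℝ) ^ 2)) +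
          Real.exp (-((1 - 12 * |β'|) * r ^ 2 / ∑ e ∈ walkEdges w, (dartMult w e : ℝ) ^ 2)) := add_le_add hup hlow
    _ = 2 * Real.exp (-((1 - 12 * |β'|) * r ^ 2 / ∑ e ∈ walkEdges w, (dartMult w e : ℝ) ^ 2)) := by ring

/-- ★★★ **Perimeter-scale Gaussian concentration of Wilson loops on every torus, closed trails, `|β'| < 1/12`**: for a closed trail `C`
(no link used twice) of positive length `|C|` whose links are distinct on the torus `(ℤ/L)³`:
`μ_{L,β'}{|W_C − ⟨W_C⟩| ≥ r} ≤ 2 exp(−(1 − 12|β'|) r²/|C|)` — the same in every volume.  Strong coupling, fixed lattice; the Yang–Mills mass gap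
is NOT proved. [cite: ShenZhuZhu2022, Theorem 1.4, Corollary 1.5, Remark 4.6] -/
theorem torus_wilsonLoop_twoSided_su2_uniform_of_isTrail {β' : ℝ} (hβ : |β'| < 1 / 12) (L : ℕ) [NeZero L]
    {x : Site 3} {w : (zdGraph 3).Walk x x} (htr : w.IsTrail) (hinj : Set.InjOn (torusEdge (d := 3) L) ↑(walkEdges w))
    (hw : 0 < w.length) {r : ℝ} (hr : 0 ≤ r) :
    ((wilsonMeasure (d := 3) (L := L) (fundamentalRep (Fin 2)) β')).real {V | r ≤ |wilsonLoopObs (fun g : Matrix.specialUnitaryGroup (Fin 2) ℂ => normalisedCharacter 2 (fundamentalRep (Fin 2) g)) w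
          (torusLift L V) -
        ∫ V', wilsonLoopObs (fun g : Matrix.specialUnitaryGroup (Fin 2) ℂ => normalisedCharacter 2 (fundamentalRep (Fin 2) g)) w
          (torusLift L V') ∂(wilsonMeasure (d := 3) (L := L) (fundamentalRep (Fin 2)) β')|} ≤
      2 * Real.exp (-((1 - 12 * |β'|) * r ^ 2 / w.length)) := by
  have h := torus_wilsonLoop_twoSided_su2_uniform hβ L w hinj hw hr
  rw [sum_dartMult_sq_eq_length_of_isTrail htr] at h
  exact h

end Summit.QuantumFields.YangMills.Theorems.ColdStartUniversality

end
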